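import Summits.BirchSwinnertonDyer.BirchSwinnertonDyer.Theorems.ThetaPartnerAtTwoKatoZetaErlKSideCMAtTwoSupplyOfDisplayedHonda
import Summits.BirchSwinnertonDyer.BirchSwinnertonDyer.Theorems.ThetaPartnerAtTwoSignedKatoUpToAtTwoOmegaDivisionCharValues
import HarnessLib

/-!
# Route `ThetaPartnerAtTwo` (TP2), K2 column — C1 `KatoZetaErlKSideCMAtTwoSupply` (stmt-BirchSwinnertonDyer-28306, HOLD) from its print
# core on the displayed Honda system IN CHARACTER-VALUE CURRENCY: «values at the even characters of `G_n` ⟹ congruence modulo `ω_n`»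

Seat `bsd-input-kz-cm-two` g0 (literature-prover, cell `pub/bsd-wall/bsd-inputs`). Sequel of `…KatoZetaErlKSideCMAtTwoSupplyOfDisplayedHonda`
(C1 ⟸ `hX` = (ERL_pair) ∧ K-side datum on the displayed frame / Honda system / local variable). HONEST FRAMING: one theorem, an
implication displaying its hypothesis; no definition, no named fact, no instance, no `sorry`; item 28306 is NOT closed; no summit
statement (BSD) is proved by this file.

## What is here

`katoZetaErlKSideCMAtTwoSupply_of_charValuesKSideOnDisplayedHonda : hXχ → C1`, where `hXχ` is `hX` with the congruence clause
(ERL_pair) «`∃ m q, 2^m (μ θ_n(f) − ν P_{n,d_n}(pair n (I.proj n s))) = ω_n q` in `Λ ⊗ ℚ₂`» REPLACED by its CHARACTER-VALUE form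
(ERL_pairχ): «for every layer `n ≥ 0` and every EVEN Dirichlet character `χ` modulo `2^{n+2}` of `2`-power order (a character of
`G_n = Gal(ℚ_n/ℚ)`, `γ = 5 ↦ χ(γ) ∈ μ_{2ⁿ}`): `ν(χ(γ)−1) · χ(P_{n,d_n}(pair n (I.proj n s))) = μ(χ(γ)−1) · Σ_{a mod 2^{n+2}} χ(a)[a/2^{n+2}]⁺_f`»
— the currency in which Kato's Thm. 12.5 (1) (values of `exp*` of the zeta element summed against `χ`) and Kobayashi's proof of
Thm. 6.3 (p. 25: «it suffices to show the interpolation properties (3.4) and (3.5)», character by character, via (8.23), Prop. 8.25,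
Prop. 8.26) are printed. The passage (ERL_pairχ) ⟹ (ERL_pair) is the K3 lineage's `Λ`-algebra, CM-blind and reused verbatim:
`SignedKatoOffTwo.CoreChi.exists_C_pow_mul_sub_eq_omega_mul_of_forall_eval` (values at all `ζ ∈ μ_{2ⁿ}` ⟹ congruence mod `ω_n`,
Weierstrass division), `…exists_even_char_apply_cyclotomicGenerator_eq` (every `ζ` is a `χ(γ)`), Birch's formula
`eval₂_mazurTateElement_eq_ratTwistedSymbolSum` (`θ_n(χ(γ)−1) = ratTwistedSymbolSum f χ`) and `tsum_map_coeff_mul_mul_pow`.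

References: [Kato2004Asterisque] Thm. 12.5 (1) (pp. 221–222), §15.16 and (15.16.1) (p. 265); [Kobayashi2003] (8.23) (p. 18), Prop. 8.25–8.26,
proof of Thm. 6.3 (pp. 24–25); [MazurTateTeitelbaum1986Invent] §I.13; [Pollack2003] Prop. 6.9 (proof); [Washington1997] §7.1–7.2;
[JohnsonLeungKings2011] Thm. 5.7, §7.2.
-/

set_option autoImplicit false
-- the Theorems namespace of this sub repeats the summit name by design (D-0017 nested layout)
set_option linter.dupNamespace false

noncomputable section

open scoped Classical NumberField MatrixGroups ModularForm

open NumberField IsDedekindDomain CongruenceSubgroup WeierstrassCurve Field Polynomial Literature Literature.NumberTheory.EllipticCurves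
  Literature.NumberTheory.GaloisRepresentations Literature.NumberTheory.EllipticCurves.ModularForms
  Literature.NumberTheory.EllipticCurves.Rank1Residual Literature.NumberTheory.EllipticCurves.IwasawaDual
  Literature.NumberTheory.EllipticCurves.Kobayashi2003 Literature.NumberTheory.EllipticCurves.Module
  Literature.NumberTheory.EllipticCurves.Kato2004 Literature.NumberTheory.EllipticCurves.Kato2004.EulerSystemValues
  Literature.NumberTheory.EllipticCurves.GreenbergSelmer Literature.NumberTheory.EllipticCurves.Sprung2012
  Literature.NumberTheory.EllipticCurves.FormalGroupChart
  ZpExtension Summit.BirchSwinnertonDyer.Rank1Residual.Supersingular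
  Summit.BirchSwinnertonDyer.Rank1Residual.Additive Summit.BirchSwinnertonDyer.Rank1Residual.Additive.PadicCyclotomicTower
  Summit.BirchSwinnertonDyer.Rank1Residual.Additive.BallEval Summit.BirchSwinnertonDyer.Rank1Residual.Additive.LocalTransport
  Summit.BirchSwinnertonDyer.BirchSwinnertonDyer.Theorems.SignedKatoOffTwo
  Summit.BirchSwinnertonDyer.BirchSwinnertonDyer.Theorems.SignedKatoOffTwo.LocalTwo

namespace Summit.BirchSwinnertonDyer.BirchSwinnertonDyer.Theorems.KatoZetaErlKSideCMAtTwo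

open Rat.HeightOneSpectrum

set_option maxHeartbeats 400000 in
/-- **C1 BY NAME ⟸ its print core on the displayed Honda system, CHARACTER-VALUE FORM.** As
`katoZetaErlKSideCMAtTwoSupply_of_erlKSideOnDisplayedHonda`, with (ERL_pair) replaced by (ERL_pairχ): for the displayed local variable `g`
(`χ₂(g) = 5`) and plus Honda system `d`, Kato's class `s ∈ 𝐇¹_Γ(T₂A)` satisfies, for `μ, ν ∈ Λ ∖ 𝔭′` and every even `2`-power-order
Dirichlet character `χ` mod `2^{n+2}`, `ν(χ(5)−1)·χ(P_{n,d_n}(pair n (I.proj n s))) = μ(χ(5)−1)·ratTwistedSymbolSum f χ` (values in `ℂ₂`,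
`F(z) = Σ_k ι(F_k) z^k`), together with ONE K-side datum `KatoDescent.KSideDatum I Y s 𝔭′`. Proof: values at every `ζ ∈ μ_{2ⁿ}` ⟹
congruence modulo `ω_n` (K3 `Λ`-algebra, CM-blind), then the previous file. CONDITIONAL on `hXχ` (published input: Kato Thm. 12.5 (1) +
(15.16.1) read on the layer pairing, Kato §15 / JLK Thm. 5.7 §7.2 for the datum); closes nothing by itself; BSD is not proved by this.
[cite: Kato2004Asterisque, Thm. 12.5 (1) (p. 221), (15.16.1) (p. 265)] [cite: Kobayashi2003, (8.23) (p. 18), Prop. 8.25–8.26 and proof of Thm. 6.3 (pp. 24–25)]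
[cite: Pollack2003, Prop. 6.9 (proof)] [cite: Washington1997, §7.1 Prop. 7.2] [cite: JohnsonLeungKings2011, Thm. 5.7 and §7.2] -/
theorem katoZetaErlKSideCMAtTwoSupply_of_charValuesKSideOnDisplayedHonda
    (hXχ :
      ∀ (v : HeightOneSpectrum (𝓞 ℚ)), ((2 : ℕ) : 𝓞 ℚ) ∈ v.asIdeal →
      ∀ (A : WeierstrassCurve ℚ) [A.IsElliptic] [A.IsGloballyMinimal],
        A.HasCM → A.analyticRank = 0 → GoodSS A 2 → A.frobeniusTrace 2 = 0 →
        2 ∣ A.shaOrder * A.tamagawaProduct →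
        ∀ (κ : ZpExtension ℚ 2) (γ : Field.absoluteGaloisGroup ℚ),
          κ.IsCyclotomic → κ.IsTopGenerator γ → IsCyclotomicVariable 2 γ →
        ∀ [NeZero (A.conductorNorm ℤ)] (f : CuspForm (Gamma0 (A.conductorNorm ℤ)) 2),
          IsNewformOf A f → ∀ (ϖ : ℚ), (ϖ : ℝ) * A.realPeriodRat = plusPeriod f →
        ∀ (Lplus Lminus : IwasawaAlgebra 2), IsPollackPair f 2 Lplus Lminus →
        ∀ [ContinuousSMul ℤ_[2] (A.tateModule 2)] (Y : A.FineSelmerDualData κ γ),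
        ∀ 𝔭' : PrimeSpectrum (IwasawaAlgebra 2), 𝔭'.asIdeal.height = 1 →
          PowerSeries.C (2 : ℤ_[2]) ∉ 𝔭'.asIdeal →
        ∀ (I : Kato2004.IwasawaH1Data A 2 κ γ)
          (pair : ∀ n : ℕ, H1 (tateRep A 2) (κ.layerSubgroup n) →ₗ[ℤ_[2]]
            (localLayerPointsOfEmb κ (closureEmb (K := ℚ) (v.adicCompletion ℚ)) A n →+ ℤ_[2])),
          (∀ (n : ℕ) (x : H1 (tateRep A 2) (κ.layerSubgroup (n + 1))) (Q : localPoints A (v.adicCompletion ℚ))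
            (hQ : Q ∈ localLayerPointsOfEmb κ (closureEmb (K := ℚ) (v.adicCompletion ℚ)) A n),
            pair n (layerCores (tateRep A 2) κ n x) ⟨Q, hQ⟩ =
              pair (n + 1) x ⟨Q, localLayerPointsOfEmb_mono κ (closureEmb (K := ℚ) (v.adicCompletion ℚ)) A (Nat.le_succ n) hQ⟩) →
          (∀ (n : ℕ) (g : Field.absoluteGaloisGroup (v.adicCompletion ℚ)) (y : H1 (tateRep A 2) (κ.layerSubgroup n))
            (Q : localPoints A (v.adicCompletion ℚ))
            (hQ : Q ∈ localLayerPointsOfEmb κ (closureEmb (K := ℚ) (v.adicCompletion ℚ)) A n),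
            pair n (conjMap (tateRep A 2).toTopRep (κ.layerSubgroup n) (resGalOfEmb (closureEmb (K := ℚ) (v.adicCompletion ℚ)) g) 1 y)
              ⟨g • Q, smul_mem_localLayerPointsOfEmb κ (closureEmb (K := ℚ) (v.adicCompletion ℚ)) A n g hQ⟩ = pair n y ⟨Q, hQ⟩) →
          (∀ (n k : ℕ) (x : H1 (tateRep A 2) (κ.layerSubgroup n))
            (Q : localLayerPointsOfEmb κ (closureEmb (K := ℚ) (v.adicCompletion ℚ)) A n),
            PadicInt.toZModPow k (pair n x Q) =
              LayerPairing.layerPairingPk A κ v (LayerPairing.weilTowerPk A) (LayerPairing.weilTowerPk_pow A)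
                (LayerPairing.weilTowerPk_add_left A) (LayerPairing.weilTowerPk_add_right A) (LayerPairing.weilTowerPk_smul A)
                n k x Q) →
        ∀ (Φ : AlgebraicClosure ℚ_[2] ≃ₐ[ℚ] AlgebraicClosure (v.adicCompletion ℚ)) (φ : ℚ_[2] ≃+* v.adicCompletion ℚ)
          (hΦφ : ∀ y : ℚ_[2], Φ (algebraMap ℚ_[2] (AlgebraicClosure ℚ_[2]) y) =
            algebraMap (v.adicCompletion ℚ) (AlgebraicClosure (v.adicCompletion ℚ)) (φ y))
          (ι : AlgebraicClosure ℚ →ₐ[ℚ] AlgebraicClosure ℚ_[2]),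
          (∀ z, closureEmb (K := ℚ) (v.adicCompletion ℚ) z = Φ (ι z)) →
        ∀ (c : ℕ → localPoints A ℚ_[2]) (σ : ℕ → Field.absoluteGaloisGroup ℚ_[2]) (d₀ : ℕ → localPoints A ℚ_[2])
          (d : ℕ → localPoints A (v.adicCompletion ℚ)),
          (haveI := isIntegral_genFib_baseChange 2 ((integralModelInt A).map (Int.castRingHom ℤ_[2]))
            ∀ m, (toLoc ((genFibΩ_eq_baseChange ((integralModelInt A).map (Int.castRingHom ℤ_[2]))).trans
                  (baseChange_twoAdicModel A))).symm (c m) ∈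
                subfieldPoints (genFibΩ 2 ((integralModelInt A).map (Int.castRingHom ℤ_[2]))) (layer 2 m).toSubfield
                  coeffs_mem_layer ∧
              (toLoc ((genFibΩ_eq_baseChange ((integralModelInt A).map (Int.castRingHom ℤ_[2]))).trans
                  (baseChange_twoAdicModel A))).symm (c m) ∈
                kernel (Valued.v (R := PadicAlgCl 2)) (genFibΩ 2 ((integralModelInt A).map (Int.castRingHom ℤ_[2]))) ∧
              ptLogΩ 2 ((integralModelInt A).map (Int.castRingHom ℤ_[2]))
                ((toLoc ((genFibΩ_eq_baseChange ((integralModelInt A).map (Int.castRingHom ℤ_[2]))).trans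
                  (baseChange_twoAdicModel A))).symm (c m)) = ell 2 m) →
          (∀ m, ∀ τ ∈ stab 2 m, τ • c m = c m) →
          (∀ m, 1 ≤ m → σ m • zeta 2 m = (zeta 2 m)⁻¹) →
          (∀ n, d₀ n = 3 • (c (n + 2) + σ (n + 2) • c (n + 2)) - 2 • c 1) →
          (∀ m, d₀ m ∈ localLayerPointsOfEmb κ ι A m) →
          (∀ m, d m = WeierstrassCurve.Affine.Point.map (W' := A)
            (Φ : AlgebraicClosure ℚ_[2] →ₐ[ℚ] AlgebraicClosure (v.adicCompletion ℚ))
            (show (A.baseChange (AlgebraicClosure ℚ_[2])).toAffine.Point from d₀ m)) →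
          (∀ m, d m ∈ localLayerPointsOfEmb κ (closureEmb (K := ℚ) (v.adicCompletion ℚ)) A m) →
          (∀ m, localTraceOfEmb κ (closureEmb (K := ℚ) (v.adicCompletion ℚ)) A (m + 1) (m + 2) (d (m + 2)) = -d m) →
          (∀ m : ℕ, 1 ≤ m → ∀ P ∈ localLayerPointsOfEmb κ (closureEmb (K := ℚ) (v.adicCompletion ℚ)) A m,
            ∃ B ∈ AddSubgroup.closure (Set.range fun τ : Field.absoluteGaloisGroup (v.adicCompletion ℚ) ↦ τ • d m),
              ∃ P' ∈ localLayerPointsOfEmb κ (closureEmb (K := ℚ) (v.adicCompletion ℚ)) A (m - 1),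
              ∃ R ∈ localLayerPointsOfEmb κ (closureEmb (K := ℚ) (v.adicCompletion ℚ)) A m, P = B + P' + 2 • R) →
          (∀ P ∈ localLayerPointsOfEmb κ (closureEmb (K := ℚ) (v.adicCompletion ℚ)) A 0,
            ∃ a : ℤ, ∃ R ∈ localLayerPointsOfEmb κ (closureEmb (K := ℚ) (v.adicCompletion ℚ)) A 0, P = a • d 0 + 2 • R) →
        ∀ (g₀ : Field.absoluteGaloisGroup ℚ_[2]) (g : Field.absoluteGaloisGroup (v.adicCompletion ℚ)),
          g = transportAut Φ.toRingEquiv g₀ (SignedEC.modelFix Φ φ hΦφ g₀) →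
          κ.IsTopGenerator (resGalOfEmb ι g₀) →
          κ.IsTopGenerator (resGalOfEmb (closureEmb (K := ℚ) (v.adicCompletion ℚ)) g) →
          ((GaloisRep.cyclotomicCharacter ℚ_[2] 2 g₀ : ℤ_[2]ˣ) : ℤ_[2]) = 5 →
          ((GaloisRep.cyclotomicCharacter (v.adicCompletion ℚ) 2 g : ℤ_[2]ˣ) : ℤ_[2]) = 5 →
          (∀ m j : ℕ, g₀ ^ j • zeta 2 m = zeta 2 m ^ 5 ^ j) →
          (∀ (k j : ℕ) (t : AlgebraicClosure (v.adicCompletion ℚ)), t ^ 2 ^ k = 1 → g ^ j • t = t ^ 5 ^ j) →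
          (∀ (W : WeierstrassCurve ℚ) (j : ℕ) (P : localPoints W ℚ_[2]),
            (show localPoints W (v.adicCompletion ℚ) from
              WeierstrassCurve.Affine.Point.map (W' := W)
                (Φ : AlgebraicClosure ℚ_[2] →ₐ[ℚ] AlgebraicClosure (v.adicCompletion ℚ))
                (show (W.baseChange (AlgebraicClosure ℚ_[2])).toAffine.Point from (g₀ ^ j • P))) =
              g ^ j • (show localPoints W (v.adicCompletion ℚ) from
                WeierstrassCurve.Affine.Point.map (W' := W)
                  (Φ : AlgebraicClosure ℚ_[2] →ₐ[ℚ] AlgebraicClosure (v.adicCompletion ℚ))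
                  (show (W.baseChange (AlgebraicClosure ℚ_[2])).toAffine.Point from P))) →
        ∃ s : I.H,
          (∃ μ ν : IwasawaAlgebra 2, μ ∉ 𝔭'.asIdeal ∧ ν ∉ 𝔭'.asIdeal ∧
            ∀ (n : ℕ) (χ : DirichletCharacter ℂ_[2] (2 ^ (n + cyclotomicExponent 2))),
              χ.Even → (∃ j : ℕ, orderOf χ = 2 ^ j) →
              (∑' k, ((algebraMap ℚ_[2] ℂ_[2]).comp (algebraMap ℤ_[2] ℚ_[2])) (PowerSeries.coeff k ν) *
                  (χ (cyclotomicGenerator 2 : ZMod (2 ^ (n + cyclotomicExponent 2))) - 1) ^ k) *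
                (∑' k, ((algebraMap ℚ_[2] ℂ_[2]).comp (algebraMap ℤ_[2] ℚ_[2]))
                    (PowerSeries.coeff k (pairingSum A (localLayerPointsOfEmb κ (closureEmb (K := ℚ) (v.adicCompletion ℚ)) A n)
                      g n (d n) (pair n (I.proj n s)))) *
                  (χ (cyclotomicGenerator 2 : ZMod (2 ^ (n + cyclotomicExponent 2))) - 1) ^ k) =
              (∑' k, ((algebraMap ℚ_[2] ℂ_[2]).comp (algebraMap ℤ_[2] ℚ_[2])) (PowerSeries.coeff k μ) *
                  (χ (cyclotomicGenerator 2 : ZMod (2 ^ (n + cyclotomicExponent 2))) - 1) ^ k) *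
                ratTwistedSymbolSum f χ) ∧
          Nonempty (KatoDescent.KSideDatum I Y s 𝔭')) :
    Summit.BirchSwinnertonDyer.BirchSwinnertonDyer.Theses.ThetaPartnerAtTwo.KatoZetaErlKSideCMAtTwoSupply := by
  refine katoZetaErlKSideCMAtTwoSupply_of_erlKSideOnDisplayedHonda
    fun v hv A _ _ hcm hr hss ha h2 κ γ hκ hγ hcv _ f hf ϖ hϖ Lplus Lminus hPP _ Y 𝔭' h𝔭' hp𝔭' I pair hP1 hP2 hP3 Φ φ hΦφ ι hι
      c σ d₀ d hcΩ hcstab hσ hd₀ hd₀L hdT hL hTR hGEN hGEN0 g₀ g hgdef hgen₀ hgen hχ₀ hχ hζpow hroots hTg ↦ ?_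
  obtain ⟨s, ⟨μ, ν, hμ, hν, hval⟩, hK⟩ :=
    hXχ v hv A hcm hr hss ha h2 κ γ hκ hγ hcv f hf ϖ hϖ Lplus Lminus hPP Y 𝔭' h𝔭' hp𝔭' I pair hP1 hP2 hP3 Φ φ hΦφ ι hι
      c σ d₀ d hcΩ hcstab hσ hd₀ hd₀L hdT hL hTR hGEN hGEN0 g₀ g hgdef hgen₀ hgen hχ₀ hχ hζpow hroots hTg
  refine ⟨s, ⟨μ, ν, hμ, hν, fun n ↦ ?_⟩, hK⟩
  refine SignedKatoOffTwo.CoreChi.exists_C_pow_mul_sub_eq_omega_mul_of_forall_eval (p := 2) n (mazurTateElement f 2 n) μ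
    (ν * pairingSum A (localLayerPointsOfEmb κ (closureEmb (K := ℚ) (v.adicCompletion ℚ)) A n) g n (d n) (pair n (I.proj n s)))
    fun ζ hζ ↦ ?_
  obtain ⟨χ, hev, hord, hχζ⟩ := SignedKatoOffTwo.CoreChi.exists_even_char_apply_cyclotomicGenerator_eq n hζ
  have hz : ‖ζ - 1‖ < 1 := norm_sub_one_lt_one_of_pow_prime_pow_eq_one hζ
  have hθ := eval₂_mazurTateElement_eq_ratTwistedSymbolSum f χ hev hord
  have h1 := hval n χ hev hord
  rw [hχζ] at hθ h1
  rw [hθ, ← h1, tsum_map_coeff_mul_mul_pow _ (norm_algebraMap_coeff_le_one _) (norm_algebraMap_coeff_le_one _) hz]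

end Summit.BirchSwinnertonDyer.BirchSwinnertonDyer.Theorems.KatoZetaErlKSideCMAtTwo

end
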